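import Literature.RepresentationTheory.TwistedCoinvariants
import Literature.RepresentationTheory.IrreducibleTwistTransport
import HarnessLib

/-!
# Irreducibility of the action on `χ`-coinvariants: transport along `mapEquiv`, along surjections on either group

Topic `RepresentationTheory`; namespace `Literature.RepresentationTheory.TwistedCoinv` (continuation of
`TwistedCoinvariants.lean`: the `χ`-coinvariants `Coinv ρW χ = S ⧸ span {ρW h v − χ h • v}` of a pair of commuting
representations `(ρV, ρW)` of `G × H` on `S`, with the induced `G`-action `rep χ ρV hc`).  Theorems only (no
definition, no record, no named fact, no `sorry`):

* `rep_comp_apply`, `isIrreducible_rep_comp_iff_of_surjective` — pulling the `G`-action back along a surjection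
  `f : G' →* G` (`rep χ (ρV ∘ f)` is `(rep χ ρV) ∘ f`) preserves and reflects irreducibility;
* `ker_comp_of_surjective`, `isIrreducible_rep_iff_of_comp_surjective_right` — pulling the ACTING group `H` back along
  a surjection `ζ : H' →* H` (and `χ ↦ χ ∘ ζ`) does not change the relation submodule, hence not the coinvariants nor
  the irreducibility of the `G`-action;
* `isIrreducible_rep_iff_of_mapEquiv` — transport along `TwistedCoinv.mapEquiv` (a linear equivalence `T : S ≃ₗ S'`
  intertwining `ρW` with a unit-scalar twist of `ρW'`, `χ' = e·χ`) that is `G`-equivariant up to unit scalars over a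
  surjection `φ : G →* G'`: `rep χ ρV` is irreducible iff `rep χ' ρV'` is (a character twist does not affect
  irreducibility, `Representation.isIrreducible_iff_of_twist_equivariant`).

Written for the Hodge/COR-CM transposition lane (item (vi), binder `hirr`): the Weil `χ`-coinvariant carrier
`ω(μ, ε, χ)` of [Liu2021, Def. 4.11] is compared with reference / place-assembled models through exactly these moves
(`GelbartRogawski1991/UnitaryDualPairWeilCoinvariantsReference.lean`, `FiniteAdelicWeilCentralCoinvariants.lean`).

## References
* D. Bump, *Automorphic forms and representations* (1997), §4.2 (twisting by a character) [Bump1997].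
* [Liu2021] Y. Liu, Camb. J. Math. 9 (2021) = arXiv:2102.11518, App. D §D.1 Step 3 (l. 5219) (the maximal
  `χ`-quotient), Def. 4.11 (l. 2092–2096).
-/

noncomputable section

namespace Literature.RepresentationTheory.TwistedCoinv

variable {k : Type*} [Field k] {G G' H H' S S' : Type*} [Group G] [Group G'] [Group H] [Group H']
  [AddCommGroup S] [Module k S] [AddCommGroup S'] [Module k S']

/-! ## §1 Pull-back of the `G`-action along a surjection -/

/-- `rep χ (ρV ∘ f) hc g' = rep χ ρV hc' (f g')` (both are induced by the operator `ρV (f g')`).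
[cite: Liu2021, App. D §D.1 Step 3 (l. 5219)] -/
theorem rep_comp_apply (ρW : Representation k H S) (χ : H →* kˣ) (ρV : Representation k G S)
    (hc : ∀ (g : G) (h : H), Commute (ρV g) (ρW h)) (f : G' →* G)
    (hc' : ∀ (g' : G') (h : H), Commute ((show Representation k G' S from ρV.comp f) g') (ρW h)) (g' : G') :
    rep χ (show Representation k G' S from ρV.comp f) hc' g' = rep χ ρV hc (f g') :=
  ext_mk ρW χ fun v => by rw [rep_mk, rep_mk, MonoidHom.comp_apply]

/-- **Pulling the `G`-action back along a SURJECTIVE `f : G' →* G` preserves and reflects irreducibility of the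
coinvariant representation.** [cite: Bump1997, §4.2 (twisting a representation by a character)] -/
theorem isIrreducible_rep_comp_iff_of_surjective (ρW : Representation k H S) (χ : H →* kˣ)
    (ρV : Representation k G S) (hc : ∀ (g : G) (h : H), Commute (ρV g) (ρW h)) (f : G' →* G)
    (hf : Function.Surjective f)
    (hc' : ∀ (g' : G') (h : H), Commute ((show Representation k G' S from ρV.comp f) g') (ρW h)) :
    (rep χ (show Representation k G' S from ρV.comp f) hc').IsIrreducible ↔ (rep χ ρV hc).IsIrreducible :=
  Representation.isIrreducible_iff_of_equivariant _ _ f hf (LinearEquiv.refl k _) fun g' x => by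
    rw [LinearEquiv.refl_apply, LinearEquiv.refl_apply, rep_comp_apply ρW χ ρV hc f hc']

/-! ## §2 Pull-back of the ACTING group along a surjection -/

/-- **The relation submodule does not change when `H` is pulled back along a surjection** `ζ : H' →* H`
(`χ ↦ χ ∘ ζ`): `ker (ρW ∘ ζ) (χ ∘ ζ) = ker ρW χ`. [cite: Liu2021, App. D §D.1 Step 3 (l. 5219)] -/
theorem ker_comp_of_surjective (ρW : Representation k H S) (χ : H →* kˣ) (ζ : H' →* H)
    (hζ : Function.Surjective ζ) :
    ker (show Representation k H' S from ρW.comp ζ) (χ.comp ζ) = ker ρW χ := by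
  refine le_antisymm ?_ ?_
  · rw [ker, Submodule.span_le]
    rintro _ ⟨⟨h', v⟩, rfl⟩
    exact sub_mem_ker ρW χ (ζ h') v
  · rw [ker, Submodule.span_le]
    rintro _ ⟨⟨h, v⟩, rfl⟩
    obtain ⟨h', rfl⟩ := hζ h
    exact sub_mem_ker (show Representation k H' S from ρW.comp ζ) (χ.comp ζ) h' v

/-- **Pulling the acting group back along a SURJECTIVE `ζ : H' →* H` does not change the irreducibility of the
`G`-action on the coinvariants** (`Coinv (ρW ∘ ζ) (χ ∘ ζ)` and `Coinv ρW χ` are the quotients by the same submodule).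
[cite: Bump1997, §4.2 (twisting a representation by a character)] -/
theorem isIrreducible_rep_iff_of_comp_surjective_right (ρW : Representation k H S) (χ : H →* kˣ)
    (ζ : H' →* H) (hζ : Function.Surjective ζ) (ρV : Representation k G S)
    (hc : ∀ (g : G) (h : H), Commute (ρV g) (ρW h))
    (hc' : ∀ (g : G) (h' : H'), Commute (ρV g) ((show Representation k H' S from ρW.comp ζ) h')) :
    (rep (χ.comp ζ) ρV hc').IsIrreducible ↔ (rep χ ρV hc).IsIrreducible :=
  Representation.isIrreducible_iff_of_equivariant _ _ (MonoidHom.id G) Function.surjective_id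
    (Submodule.quotEquivOfEq _ _ (ker_comp_of_surjective ρW χ ζ hζ)) fun g x => by
      obtain ⟨v, rfl⟩ := mk_surjective _ (χ.comp ζ) x
      rfl

/-! ## §3 Transport along `mapEquiv` -/

/-- **Irreducibility of the `G`-action on `χ`-coinvariants is transported along `mapEquiv`**: for
`T : S ≃ₗ S'` with `ρW' h (T v) = e h • T (ρW h v)`, `χ' = e·χ`, a surjection `φ : G →* G'` and units `a g` with
`ρV' (φ g) (T v) = a g • T (ρV g v)`, the representation `rep χ ρV` on `Coinv ρW χ` is irreducible iff `rep χ' ρV'` on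
`Coinv ρW' χ'` is. [cite: Bump1997, §4.2 (twisting a representation by a character)] -/
theorem isIrreducible_rep_iff_of_mapEquiv (ρW : Representation k H S) (χ : H →* kˣ) (ρW' : Representation k H S')
    (χ' : H →* kˣ) (ρV : Representation k G S) (ρV' : Representation k G' S')
    (hc : ∀ (g : G) (h : H), Commute (ρV g) (ρW h)) (hc' : ∀ (g' : G') (h : H), Commute (ρV' g') (ρW' h))
    (T : S ≃ₗ[k] S') (e : H → kˣ) (hT : ∀ (h : H) (v : S), ρW' h (T v) = ((e h : kˣ) : k) • T (ρW h v))
    (hχ : ∀ h : H, χ' h = e h * χ h) (φ : G →* G') (hφ : Function.Surjective φ) (a : G → kˣ)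
    (hg : ∀ (g : G) (v : S), ρV' (φ g) (T v) = ((a g : kˣ) : k) • T (ρV g v)) :
    (rep χ ρV hc).IsIrreducible ↔ (rep χ' ρV' hc').IsIrreducible :=
  Representation.isIrreducible_iff_of_twist_equivariant (rep χ ρV hc) (rep χ' ρV' hc') φ hφ
    (mapEquiv ρW χ ρW' χ' T e hT hχ) (fun g => (a g)⁻¹) fun g x => by
      rw [mapEquiv_rep ρW χ ρW' χ' ρV ρV' hc hc' T e hT hχ (hg g), smul_smul, Units.inv_mul, one_smul]

/-- **Same space, same acting pair, two `G`-actions differing by unit scalars on `S`**: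
`ρV₂ g = a g • ρV₁ g` ⟹ (`rep χ ρV₁` irreducible ↔ `rep χ ρV₂` irreducible).
[cite: Bump1997, §4.2 (twisting a representation by a character)] -/
theorem isIrreducible_rep_iff_of_forall_eq_units_smul (ρW : Representation k H S) (χ : H →* kˣ)
    (ρV₁ ρV₂ : Representation k G S) (hc₁ : ∀ (g : G) (h : H), Commute (ρV₁ g) (ρW h))
    (hc₂ : ∀ (g : G) (h : H), Commute (ρV₂ g) (ρW h)) (a : G → kˣ)
    (hg : ∀ (g : G) (v : S), ρV₂ g v = ((a g : kˣ) : k) • ρV₁ g v) :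
    (rep χ ρV₁ hc₁).IsIrreducible ↔ (rep χ ρV₂ hc₂).IsIrreducible :=
  isIrreducible_rep_iff_of_mapEquiv ρW χ ρW χ ρV₁ ρV₂ hc₁ hc₂ (LinearEquiv.refl k S) (fun _ => 1)
    (fun h v => by rw [Units.val_one, one_smul]; rfl) (fun h => by rw [one_mul]) (MonoidHom.id G)
    Function.surjective_id a fun g v => hg g v

end Literature.RepresentationTheory.TwistedCoinv

end
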